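import Literature.Probability.Percolation.SlabRSWGluingLinear
import Literature.Probability.Percolation.InequalitiesProofs
import HarnessLib

/-!
# Newman–Tassion–Wu 2017, §3.4 (proof of Theorem 3.10): non-uniqueness of the crossing cluster costs a
# disjoint occurrence — `P[X ⟷^B Y, not uniquely] ≤ P[X ⟷^B Y]²`

Topic: `Literature/Probability/Percolation`. In the proof of NTW's Theorem 3.10 the events `𝒰_i`
("there exists a unique cluster in the configuration restricted to `S_i` that intersects both ends
of `S_i`") are controlled by (3.72): "the occurrence of the event `𝓔₀ ∖ 𝒰₁` implies the existence of
two disjoint open paths from `B(S₁)` to `R(S₁)` inside `S₁` … Using first independence and then the BK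
inequality …". This file proves the deterministic half and the BK step for the tree's crossing events
of the slab: if `X ⟷^B Y` holds but not with a unique cluster (DST's `slabUniqueConn`), two
vertex-disjoint open crossings exist, so the crossing event OCCURS DISJOINTLY with itself; by the BK
inequality of the tree (`bk_inequality_holds`) the probability is at most `P[X ⟷^B Y]²`.

* `slabConn_diff_slabUniqueConn_subset`, `real_slabConn_not_unique_le_sq`.

## Sources

* C. M. Newman, V. Tassion, W. Wu, *Critical percolation and the minimal spanning tree in slabs*,
  Comm. Pure Appl. Math. 70 (2017), arXiv:1512.09107: §3.4, proof of Theorem 3.10, (3.66)–(3.72)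
  [NewmanTassionWu2017]; BK: van den Berg–Kesten 1985 / Grimmett 1999 Thm 2.12 (tree: `bk_inequality_holds`).
-/

noncomputable section

namespace Literature.Probability.Percolation

open MeasureTheory LatticeModels SimpleGraph
open scoped Literature.Probability.Percolation

namespace NTW17

variable {k : ℕ}

/-- The edges of an open self-avoiding path form a configuration containing that path.
[cite: NewmanTassionWu2017, §3.4 (proof of Theorem 3.10, "two disjoint open paths")] -/
theorem isOSAP_edgesOf {ω : BondConfig (slab 3 k)} {S X Y : Set (slab 3 k)} {l : List (slab 3 k)}
    (hl : IsOSAP k ω S X Y l) : IsOSAP k (edgesOf l) S X Y l := by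
  refine ⟨hl.nodup, ?_, hl.subset, hl.ne_nil, hl.head_mem, hl.last_mem⟩
  have hch := hl.chain
  rw [List.isChain_iff_forall_rel_of_append_cons_cons] at hch ⊢
  intro a b l₁ l₂ h
  exact ⟨mem_edgesOf_of_eq h, (hch h).2⟩

/-- The edges of an open path are open. [cite: NewmanTassionWu2017, §3.4 (proof of Theorem 3.10)] -/
theorem edgesOf_subset_of_isOSAP {ω : BondConfig (slab 3 k)} {S X Y : Set (slab 3 k)} {l : List (slab 3 k)}
    (hl : IsOSAP k ω S X Y l) : edgesOf l ⊆ ω := by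
  rintro e ⟨a, b, l₁, l₂, h, rfl⟩
  have hch := hl.chain
  rw [List.isChain_iff_forall_rel_of_append_cons_cons] at hch
  exact (hch h).1

/-- **Non-uniqueness gives a disjoint occurrence**: if `X ⟷^B Y` holds but the open clusters of `B̄`
joining `X̄` to `Ȳ` are not all the same (`¬ slabUniqueConn`), then two vertex-disjoint open crossings
exist, so `X ⟷^B Y` occurs disjointly with itself.
[cite: NewmanTassionWu2017, §3.4 (proof of Theorem 3.10: "𝓔₀ ∖ 𝒰₁ implies the existence of two disjoint open paths from B(S₁) to R(S₁) inside S₁")] -/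
theorem slabConn_diff_slabUniqueConn_subset (B X Y : Set (ℤ × ℤ)) :
    slabConn k B X Y \ slabUniqueConn k B X Y ⊆ slabConn k B X Y □ slabConn k B X Y := by
  rintro ω ⟨hconn, hnu⟩
  have hnu' : ¬∀ x ∈ slabLift k X, ∀ x' ∈ slabLift k X, ∀ y ∈ slabLift k Y, ∀ y' ∈ slabLift k Y,
      ω ∈ openConnIn (slabLift k B) x y → ω ∈ openConnIn (slabLift k B) x' y' →
        ω ∈ openConnIn (slabLift k B) x x' := fun h => hnu ⟨hconn, h⟩
  push Not at hnu'
  obtain ⟨x, hx, x', hx', y, hy, y', hy', hxy, hx'y', hxx'⟩ := hnu'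
  obtain ⟨l₁, hl₁⟩ := exists_isOSAP_of_openConnIn hxy
  obtain ⟨l₂, hl₂⟩ := exists_isOSAP_of_openConnIn hx'y'
  have hh₁ : l₁.head hl₁.ne_nil = x := by
    have := hl₁.head_mem hl₁.ne_nil; rwa [Set.mem_singleton_iff] at this
  have hh₂ : l₂.head hl₂.ne_nil = x' := by
    have := hl₂.head_mem hl₂.ne_nil; rwa [Set.mem_singleton_iff] at this
  -- the two paths share no vertex
  have hdisjv : ∀ v ∈ l₁, v ∉ l₂ := by
    intro v hv₁ hv₂
    have h1 := hl₁.openConnIn_of_mem hv₁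
    have h2 := hl₂.openConnIn_of_mem hv₂
    rw [hh₁] at h1; rw [hh₂] at h2
    exact hxx' (SlabCriticality.openConnIn_trans h1 (openConnIn_reverse h2))
  -- the witnesses: the edge sets of the two paths
  have hup : IsUpperSet (slabConn k B X Y) := isUpperSet_openCrossing _ _ _
  rw [hup.mem_disjointOccurrence_iff hup]
  refine ⟨edgesOf l₁, edgesOf_subset_of_isOSAP hl₁, edgesOf l₂, edgesOf_subset_of_isOSAP hl₂, ?_, ?_, ?_⟩
  · rw [Set.disjoint_left]
    rintro e ⟨a, b, m₁, m₂, h, rfl⟩ he₂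
    have ha₁ : a ∈ l₁ := by rw [h]; simp
    exact hdisjv a ha₁ (mem_of_mem_edgesOf he₂).1
  · refine (mem_slabConn_iff_exists_isOSAP _ _ _ _).2 ⟨l₁, ?_⟩
    have h := isOSAP_edgesOf hl₁
    exact ⟨h.nodup, h.chain, h.subset, h.ne_nil, fun hne => by rw [hh₁]; exact hx,
      fun hne => by have := hl₁.last_mem hne; rw [Set.mem_singleton_iff] at this; rw [this]; exact hy⟩
  · refine (mem_slabConn_iff_exists_isOSAP _ _ _ _).2 ⟨l₂, ?_⟩
    have h := isOSAP_edgesOf hl₂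
    exact ⟨h.nodup, h.chain, h.subset, h.ne_nil, fun hne => by rw [hh₂]; exact hx',
      fun hne => by have := hl₂.last_mem hne; rw [Set.mem_singleton_iff] at this; rw [this]; exact hy'⟩

/-- **BK step of (3.72)**: for a finite planar set `B`, `P_p[X ⟷^B Y, not with a unique cluster] ≤
P_p[X ⟷^B Y]²`. [cite: NewmanTassionWu2017, §3.4 (proof of Theorem 3.10, (3.72): "then the BK inequality")] -/
theorem real_slabConn_not_unique_le_sq {B : Set (ℤ × ℤ)} (hB : B.Finite) (X Y : Set (ℤ × ℤ))
    (p : unitInterval) :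
    (bondPercolation (slabGraph 3 k) p).real (slabConn k B X Y \ slabUniqueConn k B X Y) ≤
      (bondPercolation (slabGraph 3 k) p).real (slabConn k B X Y) ^ 2 := by
  have hup : IsUpperSet (slabConn k B X Y) := isUpperSet_openCrossing _ _ _
  have hloc : IsLocalEvent (slabConn k B X Y) := by
    refine ⟨(finite_sym2 (slabLift_finite k hB)).toFinset, ?_⟩
    rw [Set.Finite.coe_toFinset]
    exact determinedBy_slabConn k X Y subset_rfl
  calc (bondPercolation (slabGraph 3 k) p).real (slabConn k B X Y \ slabUniqueConn k B X Y)
      ≤ (bondPercolation (slabGraph 3 k) p).real (slabConn k B X Y □ slabConn k B X Y) :=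
        measureReal_mono (slabConn_diff_slabUniqueConn_subset B X Y) (measure_ne_top _ _)
    _ ≤ (bondPercolation (slabGraph 3 k) p).real (slabConn k B X Y) *
          (bondPercolation (slabGraph 3 k) p).real (slabConn k B X Y) :=
        bk_inequality_holds (slabGraph 3 k) p hup hup hloc hloc
    _ = _ := (sq _).symm

end NTW17

end Literature.Probability.Percolation

end
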